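/-
Copyright: lit-balaban Phase-2 proof seat p31 (gen 3).  Statement-level skeleton of a published paper; no proof claims beyond what the
kernel checks below.
-/
import Literature.MathematicalPhysics.QuantumFieldTheory.BalabanImbrieJaffe1984to88.BIJ85Eq454Holonomy
import Literature.MathematicalPhysics.QuantumFieldTheory.BalabanImbrieJaffe1984to88.BIJ88Sect3Translations

/-!
# `BalabanImbrieJaffe1984to88.BIJ88SurfacePhase325` — T. Bałaban, J. Imbrie, A. Jaffe, *Effective action and cluster properties of the
abelian Higgs model*, Commun. Math. Phys. **114** (1988) 257–315 [BalabanImbrieJaffe1988]: the surface-phase identity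
`(Q^{s*}v)(∂p) = e^{ie₀L^{−2}(Q^{e*}f)(p)}` behind (3.25) p. 269 and the plaquette field (4.13) of the background field (4.2) p. 274–275,
DISCHARGED ON THE TORI from [BalabanImbrieJaffe1985] (4.5.3)/Remark 2 (`BIJ85Eq454Holonomy`)

statement-level skeleton of published theorems with citation tags; proofs where landed; nothing here is a claim about the Yang–Mills mass gap

PDF held: `paper:balaban1988-cmp114-bij-abelian-higgs` (journal page = PDF page + 256); the displays (3.24)–(3.26) p. 269, (4.2) p. 274,
(4.13) p. 275 are quoted from the typed carriers `BIJ88Sect3Translations` / `BIJ88Sect4Statements` (reader r18), whose docstrings carry them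
verbatim; [BalabanImbrieJaffe1985] pp. 312–318 as in `BIJ85Eq454Holonomy`.

CITATION HEADER (lean-in-tree rule).  Part of the lit-balaban TYPED SKELETON (HOME `run/shared/lean/pub/lit-balaban/`), Phase-2 seat p31
(gen 3); rows **C2.Eq3.25** (PROVED by r18 `BIJ88Sect3Translations.eq325` UNDER the hypothesis `SurfacePhase` = *"the [2] (2.19) identity
(Q^{s*}v)(∂p) = e^{ie₀L^{−2}(Q^{e*}f)(p)} on Λ₁** as hypothesis on the data"*), **C2.Eq4.2** / **C2.Eq4.13** (typed, `BIJ88Sect4Statements.backgroundU`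
over the abstract datum `Qssu = Q^{s*}_ku`, `fK`) of `HOME/SKELETON.md` (reader files `HOME/lit-balaban-r18/ROWS-C2*.md`).

THE PRINTED TEXT (as carried by the typed rows).  (3.24) p. 269: *"u_b = u′_bu_{b′} if b ∈ B^s(b′) ∩ Λ₁^{(0)*}, u′_b otherwise, ≡
u′_b(Λ₁^{(0)*}Q^{s*}v)_b"*; (3.25): *"The quadratic form for the gauge field in Λ₁^{(0)**} is ⟨Λ₁^{(0)**}f^{(0)}, Λ₁^{(0)**}f^{(0)}⟩ =
⟨Λ₁^{(0)**}(∂A′ + L^{−2}Q^{e*}f), Λ₁^{(0)**}(∂A′ + L^{−2}Q^{e*}f)⟩"*; (3.26): *"f(p) = (ie₀)^{−1} log v(p)"*; (4.2) p. 274: *"u_k = (Q^{s*}_ku)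
exp(−ie_kη𝒟_{k,loc}∂^*Q^{e*}_kf^{(k)}), (4.2) where f^{(k)}(p) = (ie_k)^{−1} log u(p). This is just a localized version of (I.4.5.4)"*;
(4.13) p. 275: *"f_k(p) = (ie_kη²)^{−1} log u_k(p)"*.

WHAT IS REPRODUCED, and how.  The surface field `w = Q^{s*}v` and the background field `u_k` enter r18's typing as abstract ℂ-valued bond
functions (`SurfacePhase … w …`, `backgroundU … Qssu …`).  Here they are INSTANTIATED on the tori of `Balaban1983to89.Setup` by the objects
of [BalabanImbrieJaffe1985] Sect. 4.5 as typed/proved in the C1 files: `w` = the U(1) field `expField (e₀η) (Q^{s*}B)` of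
`BIJ85Eq454Holonomy` (`Q^{s*}` = `BlockBonds.Qsstar` of the one-step torus geometry `BIJ85Eq219Proof.torusBlockBonds`, `v = exp(ie₀B)`,
`ηL = 1`; values = [BalabanImbrieJaffe1985] (4.5.2) `BlockBonds.QsstarGroup`), coerced to `ℂ`.  PROVED: (i) `plaqVar` of a U(1)-valued bond
function is the C1 plaquette variable `BIJ85Sect1Model.plaq` (`plaqVar_coe`); (ii) **the hypothesis `SurfacePhase` of `eq325` HOLDS on every
plaquette set**, with `g = Q^{e*}f`, `Q^{e*}` = `Cells.Qstar` of `BIJ85CurlQsstar.torusEdgeCells` (factor `L²`, [BalabanImbrieJaffe1985] (2.22))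
and `f = (ie₀)^{−1} ln v(∂·)` (`surfacePhase_torus`) — so (3.25) holds on the tori under the small-field hypothesis alone
(`eq325_torus`); (iii) the k-fold background field (4.2) over the instantiated `Q^{s*}_ku` IS the C1 background field (I.4.5.4)
(`backgroundU_torus`; `BlockBonds.backgroundField` via `BIJ85Eq454Holonomy.coe_expField_background`), and its plaquette field (4.13) (principal
`log`) is `(Q^{e*}_kf^{(k)})(p) − (∂X)(p)`, `X` the supplied bond function (𝒟_{k,loc}∂^*Q^{e*}_kf^{(k)} in the paper), whenever `e_kη²` times it
lies in `(−π, π)` (`fK_background_torus`; [BalabanImbrieJaffe1985] Remark 2 p. 317 = `BIJ85Eq454Holonomy.plaq_background_eq_exp`).  Standing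
range `j + 1 ≤ m + K` / `i + k ≤ m + K`, `2 ≤ d`, `e₀ ≠ 0`.  NOTHING beyond the kernel-checked identities is asserted; the regions Λ, the
operators 𝒟_{k,loc}, G and the estimates of Sects. 2–5 are not touched.  Unit `lit-balaban-p31` (literature-prover-lit-balaban-p31-g3-0),
2026-08-21.
-/

open scoped BigOperators Real

namespace Literature.MathematicalPhysics.QuantumFieldTheory.BalabanImbrieJaffe1984to88.BIJ88SurfacePhase325

open Literature.MathematicalPhysics.QuantumFieldTheory.Balaban1983to89
open BIJ85Sect2SurfaceAverages BIJ85CellAverages LatticeFieldCalculus BIJ85Eq219Proof BIJ85CurlQsstar BIJ85Eq224Proof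
  BIJ85Eq224ProofPart2 BIJ85Sect1Model BIJ85SmallFieldSplit64 BIJ85Eq454Holonomy
open BIJ88Sect3Statements BIJ88Sect4Statements BIJ88Sect3Translations
open Complex

variable {P : Params} {i j : ℕ}

/-! ## 1. The C2 plaquette variable of a U(1)-valued bond function -/

/-- kernel: r18's ℂ-valued plaquette variable `plaqVar` (conjugates on the reversed bonds) of a U(1)-valued bond function is the C1 plaquette
variable `plaq` (inverses on the reversed bonds): on the unit circle `conj = inv`. [cite: BalabanImbrieJaffe1988, (3.3) p.265] -/
theorem plaqVar_coe (u : U1Field P j) (p : Plaq P j) :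
    plaqVar (fun b => ((u b : Circle) : ℂ)) p = ((plaq u p : Circle) : ℂ) := by
  simp only [plaqVar, plaq, Circle.coe_mul, Circle.coe_inv_eq_conj]

/-! ## 2. (3.25): the surface-phase hypothesis holds on the tori -/

/-- **The datum of (3.25)** p. 269 [PDF 13] — *"(Q^{s*}v)(∂p) = e^{ie₀L^{−2}(Q^{e*}f)(p)}"*, r18's `SurfacePhase`, there a HYPOTHESIS on the
abstract surface field `w` — PROVED on the tori for `w = Q^{s*}v` = [BalabanImbrieJaffe1985] (4.5.2) at one step (`expField (e₀η) (Q^{s*}B)`,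
`v = exp(ie₀B)` on the L-lattice `T^{(j+1)}`, `ηL = 1`) with `g = Q^{e*}f`, `f = (ie₀)^{−1} ln v(∂·)` ((3.26)), on EVERY plaquette set `Λ₁**`:
edge plaquettes carry `v(∂p′)`, all others `1` (`BIJ85Eq454Holonomy.plaq_Qsstar1U1_eq_exp`); `e₀ ≠ 0` (standing range, `2 ≤ d`).
[cite: BalabanImbrieJaffe1988, (3.25) p.269] -/
theorem surfacePhase_torus (hj : j + 1 ≤ P.m + P.K) (hd : 2 ≤ P.d) {e₀ : ℝ} (he : e₀ ≠ 0) (η : ℝ) (hη : η * (P.L : ℝ) = 1)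
    (B : PBond P (j + 1) → ℝ) (Λ₁pp : Finset (Plaq P j)) :
    SurfacePhase Λ₁pp (fun b => ((expField (e₀ * η) ((torusBlockBonds P j).Qsstar B) b : Circle) : ℂ)) e₀ P.L
      ((torusEdgeCells P j hd).Qstar (plaqField e₀ (expField e₀ B))) := by
  intro p _
  have hL : (P.L : ℝ) ≠ 0 := Nat.cast_ne_zero.mpr P.L_pos.ne'
  have hη' : η = (P.L : ℝ)⁻¹ := eq_inv_of_mul_eq_one_left hη
  rw [plaqVar_coe, plaq_Qsstar1U1_eq_exp hj hd he η hη B p, Circle.coe_exp]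
  congr 1
  rw [hη', zpow_neg, zpow_ofNat, inv_pow]
  push_cast
  ring

/-- **(3.25)** p. 269 [PDF 13] ON THE TORI: r18's `eq325` with its surface-phase hypothesis DISCHARGED by `surfacePhase_torus` — for the
translated field (3.24) `u = u′·(Λ₁*Q^{s*}v)`, `u′ = e^{ie₀A′}`, `Q^{s*}v` the instantiated surface field, the gauge-field quadratic form over
`Λ₁**` is `Σ_{p∈Λ₁**}((∂A′)(p) + L^{−2}(Q^{e*}f)(p))²` under the small-field (principal-branch) hypothesis only; `e₀ ≠ 0`, `ηL = 1` (standing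
range, `2 ≤ d`). [cite: BalabanImbrieJaffe1988, (3.25) p.269] -/
theorem eq325_torus (hj : j + 1 ≤ P.m + P.K) (hd : 2 ≤ P.d) {e₀ : ℝ} (he : e₀ ≠ 0) (η : ℝ) (hη : η * (P.L : ℝ) = 1)
    (B : PBond P (j + 1) → ℝ) {Λ₁star : Finset (PBond P j)} {Λ₁pp : Finset (Plaq P j)}
    (hpp : ∀ p ∈ Λ₁pp, (⟨p.src, p.μ⟩ : PBond P j) ∈ Λ₁star ∧ (⟨p.src.shift p.μ, p.ν⟩ : PBond P j) ∈ Λ₁star ∧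
      (⟨p.src.shift p.ν, p.μ⟩ : PBond P j) ∈ Λ₁star ∧ (⟨p.src, p.ν⟩ : PBond P j) ∈ Λ₁star)
    (A' : PBond P j → ℝ)
    (hsmall : ∀ p ∈ Λ₁pp, |e₀ * (curl 1 A' p + (P.L : ℝ) ^ (-(2 : ℤ)) *
      (torusEdgeCells P j hd).Qstar (plaqField e₀ (expField e₀ B)) p)| < Real.pi) :
    plaqForm Λ₁pp (fun p => (fieldStrength e₀ (plaqVar
        (u324 Λ₁star (phase e₀ A') (fun b => ((expField (e₀ * η) ((torusBlockBonds P j).Qsstar B) b : Circle) : ℂ))) p)).re) =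
      plaqForm Λ₁pp (fun p => curl 1 A' p + (P.L : ℝ) ^ (-(2 : ℤ)) * (torusEdgeCells P j hd).Qstar (plaqField e₀ (expField e₀ B)) p) :=
  eq325 he (surfacePhase_torus hj hd he η hη B Λ₁pp) hpp A' hsmall

/-! ## 3. (4.2) and (4.13) over the instantiated `Q^{s*}_ku` -/

/-- **(4.2)** p. 274 [PDF 18] — *"u_k = (Q^{s*}_ku) exp(−ie_kη𝒟_{k,loc}∂^*Q^{e*}_kf^{(k)}) … just a localized version of (I.4.5.4)"* — with
r18's abstract datum `Qssu = Q^{s*}_ku` INSTANTIATED by [BalabanImbrieJaffe1985] (4.5.2) on the k-fold torus geometry (`expField (e_kη)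
(Q^{s*}_kB)`, `u = exp(ie_kB)` on the unit lattice `T^{(i+k)}`): `backgroundU` IS the U(1) field `expField (e_kη) (Q^{s*}_kB − g)` (whose values
are `BlockBonds.backgroundField`, `BIJ85Eq454Holonomy.coe_expField_background`), `g` the supplied bond function.
[cite: BalabanImbrieJaffe1988, (4.2) p.274] -/
theorem backgroundU_torus (k : ℕ) (ek η : ℝ) (B : PBond P (i + k) → ℝ) (g : PBond P i → ℝ) :
    backgroundU ek η (fun b => ((expField (ek * η) ((torusBlockBondsIter P i k).Qsstar B) b : Circle) : ℂ)) g =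
      fun b => ((expField (ek * η) (fun b => (torusBlockBondsIter P i k).Qsstar B b - g b) b : Circle) : ℂ) := by
  funext b
  simp only [backgroundU, expField, Circle.coe_exp, ← Complex.exp_add]
  congr 1
  push_cast
  ring

/-- kernel: r18's (4.13) `f_k = (ie_kη²)^{−1} log(·)` (principal `log`) evaluated at a phase `e^{iθ}` with `θ = e_kη²·t`, `|θ| < π`, is `t`
(`e_k ≠ 0`, `η ≠ 0`). [cite: BalabanImbrieJaffe1988, (4.13) p.275] -/
theorem fK_exp_of_small {ek η t : ℝ} (he : ek ≠ 0) (hη : η ≠ 0) (hsmall : |ek * η ^ 2 * t| < Real.pi) :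
    fK ek η (Complex.exp (((ek * η ^ 2 * t : ℝ) : ℂ) * I)) = (t : ℂ) := by
  have h1 : -Real.pi < ((((ek * η ^ 2 * t : ℝ) : ℂ) * I)).im := by
    simp only [mul_im, I_re, I_im, ofReal_re, ofReal_im, mul_zero, mul_one]
    linarith [neg_abs_le (ek * η ^ 2 * t)]
  have h2 : ((((ek * η ^ 2 * t : ℝ) : ℂ) * I)).im ≤ Real.pi := by
    simp only [mul_im, I_re, I_im, ofReal_re, ofReal_im, mul_zero, mul_one]
    linarith [le_abs_self (ek * η ^ 2 * t)]
  rw [fK, Complex.log_exp h1 h2]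
  have he' : (ek : ℂ) ≠ 0 := ofReal_ne_zero.2 he
  have hη' : (η : ℂ) ≠ 0 := ofReal_ne_zero.2 hη
  field_simp
  push_cast
  ring

/-- **(4.13)** p. 275 [PDF 19] for the instantiated background field (4.2): `f_k(p) = (ie_kη²)^{−1} log u_k(p) = (Q^{e*}_kf^{(k)})(p) − (∂g)(p)`
with `f^{(k)} = (ie_k)^{−1} ln u(∂·)` on the unit lattice, `Q^{e*}_k` = `Cells.Qstar` of the k-fold edge geometry (factor `L^{2k}`), `∂ = curl η⁻¹`
the η-lattice curl and `g` the supplied bond function (𝒟_{k,loc}∂^*Q^{e*}_kf^{(k)} in the paper) — [BalabanImbrieJaffe1985] Remark 2 p. 317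
(`BIJ85Eq454Holonomy.plaq_background_eq_exp`) read through the principal `log`, valid whenever `e_kη²·[(Q^{e*}_kf^{(k)})(p) − (∂g)(p)] ∈ (−π, π)`;
`e_k ≠ 0`, `ηL^k = 1` (standing range, `2 ≤ d`). [cite: BalabanImbrieJaffe1988, (4.13) p.275] -/
theorem fK_background_torus (hd : 2 ≤ P.d) {k : ℕ} (hk : i + k ≤ P.m + P.K) {ek : ℝ} (he : ek ≠ 0) (η : ℝ)
    (hη : η * (P.L : ℝ) ^ k = 1) (B : PBond P (i + k) → ℝ) (g : PBond P i → ℝ) (p : Plaq P i)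
    (hsmall : |ek * η ^ 2 * ((torusEdgeCellsIter P i k hd).Qstar (plaqField ek (expField ek B)) p - curl η⁻¹ g p)| < Real.pi) :
    fK ek η (plaqVar (backgroundU ek η (fun b => ((expField (ek * η) ((torusBlockBondsIter P i k).Qsstar B) b : Circle) : ℂ)) g) p) =
      (((torusEdgeCellsIter P i k hd).Qstar (plaqField ek (expField ek B)) p - curl η⁻¹ g p : ℝ) : ℂ) := by
  have hη0 : η ≠ 0 := by rintro rfl; simp at hη
  rw [backgroundU_torus, plaqVar_coe, plaq_background_eq_exp hd hk he η hη B g p, Circle.coe_exp]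
  exact fK_exp_of_small he hη0 hsmall

end Literature.MathematicalPhysics.QuantumFieldTheory.BalabanImbrieJaffe1984to88.BIJ88SurfacePhase325
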